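import Mathlib.Topology.Algebra.RestrictedProduct.TopologicalSpace
import Mathlib.Topology.Algebra.Nonarchimedean.Basic
import Mathlib.Topology.Algebra.OpenSubgroup
import Literature.NumberTheory.Automorphic.RestrictedTensorProductSmoothProofs
import HarnessLib

/-!
# Coordinate embeddings and box subgroups of a restricted product of groups

Topic `NumberTheory/Automorphic`. Elementary structure of the restricted product
`Γ = Πʳ i, [G i, K i]` (Mathlib `RestrictedProduct`, cofinite filter, with Mathlib's topology) of
groups `G i` with respect to subgroups `K i`, as needed for the internal proof of Flath's tensor
product theorem (`flath_exists` of `AutomorphicGLn`; Flath, Corvallis 1979, §2 Example 2 and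
Thm. 3; Bump (1997), §3.3–3.4):

* `mulSingleHom K i : G i →* Γ` — Mathlib's coordinate embedding `RestrictedProduct.mulSingle`
  bundled as a homomorphism; `continuous_mulSingle`; every `γ ∈ Γ` factors as `γ = c · ι_i(γ i)`
  with `c i = 1`, and such `c` commute with `ι_i(G i)` (`exists_eq_mul_mulSingleHom`, the
  hypothesis `hφ` of `FlathLocalLemmas.fixedPoints_comp_eq_bot_of_inf_eq_bot`); coordinate
  embeddings at distinct indices commute.
* `boxSubgroup L = {g | ∀ i, g i ∈ L i}` for a family of subgroups `L i ≤ G i` — a subgroup of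
  `Γ`; open when the `L i` are open and `K i ≤ L i` for almost all `i`
  (`isOpen_setOf_forall_mem_restrictedProduct` of `RestrictedTensorProductSmoothProofs`), compact
  when `L i ≤ K i` are compact for all `i` (continuous image of `∏ L i` under the structure map).
* `exists_boxSubgroup_subset` — for locally profinite factors (`NonarchimedeanGroup`) and compact
  open `K i`, every neighbourhood of `1` in `Γ` contains a box `∏ L i` with `L i ≤ K i` compact
  open and `L i = K i` for almost all `i` (Mathlib `RestrictedProduct.nhds_eq_map_structureMap`
  and `nhds_pi`). These are the basic compact open subgroups `K_S' × K^S` of Flath, §2, Example 2.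

All statements are standard (folklore); Mathlib has `mulSingle`, the structure map and the
description of `𝓝 1`, but neither the bundled homomorphism nor box subgroups
(`lean search 'boxSubgroup|mulSingleHom'`: nothing).

## References

* D. Flath, *Decomposition of representations into tensor products*, Proc. Sympos. Pure Math. 33
  (1979), part 1, §2, Example 2 [FlathCorvallis1979].
* D. Bump, *Automorphic forms and representations* (1997), §3.3, pp. 293–296 [Bump1997].
-/

open scoped RestrictedProduct
open Filter
open _root_.Topology

namespace Literature.NumberTheory.Automorphic

universe u v

variable {ι : Type u} {G : ι → Type v} [∀ i, Group (G i)] {K : ∀ i, Subgroup (G i)}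

/-! ### The coordinate embeddings -/

section Coordinate

variable [DecidableEq ι]

variable (K) in
/-- The coordinate embedding `ι_i : G i →* Πʳ i, [G i, K i]`, `x ↦ (1, …, 1, x, 1, …)`
(Mathlib's `RestrictedProduct.mulSingle`, bundled as a group homomorphism).
(Flath 1979, §2; Bump 1997, §3.3.) [folklore] -/
def mulSingleHom (i : ι) : G i →* Πʳ i, [G i, K i] where
  toFun := RestrictedProduct.mulSingle K i
  map_one' := RestrictedProduct.mulSingle_one K i
  map_mul' := RestrictedProduct.mulSingle_mul K i

/-- Unfolding of `mulSingleHom`. [folklore] -/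
@[simp] theorem mulSingleHom_apply (i : ι) (x : G i) :
    mulSingleHom K i x = RestrictedProduct.mulSingle K i x := rfl

/-- Coordinates of `mulSingleHom K i x`. [folklore] -/
theorem mulSingleHom_apply_apply (i : ι) (x : G i) (j : ι) :
    mulSingleHom K i x j = Pi.mulSingle i x j := rfl

/-- `mulSingleHom K i` is injective. [folklore] -/
theorem mulSingleHom_injective (i : ι) : Function.Injective (mulSingleHom K i) :=
  RestrictedProduct.mulSingle_injective K i

/-- An element of the restricted product with trivial `i`-th coordinate commutes with the image
of the `i`-th coordinate embedding. [folklore] -/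
theorem mul_mulSingle_comm_of_apply_eq_one {c : Πʳ i, [G i, K i]} {i : ι} (hc : c i = 1)
    (x : G i) :
    c * RestrictedProduct.mulSingle K i x = RestrictedProduct.mulSingle K i x * c := by
  refine DFunLike.ext _ _ fun j => ?_
  simp only [RestrictedProduct.mul_apply, RestrictedProduct.coe_mulSingle_apply]
  by_cases hj : j = i
  · subst hj
    rw [hc, Pi.mulSingle_eq_same, one_mul, mul_one]
  · rw [Pi.mulSingle_eq_of_ne hj, mul_one, one_mul]

/-- The element `γ · ι_i(γ i)⁻¹` has trivial `i`-th coordinate. [folklore] -/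
@[simp] theorem mul_mulSingle_inv_apply_self (γ : Πʳ i, [G i, K i]) (i : ι) :
    (γ * (RestrictedProduct.mulSingle K i (γ i))⁻¹) i = 1 := by
  simp [RestrictedProduct.mul_apply, RestrictedProduct.inv_apply]

/-- The element `γ · ι_i(γ i)⁻¹` has the same `j`-th coordinate as `γ` for `j ≠ i`. [folklore] -/
theorem mul_mulSingle_inv_apply_of_ne (γ : Πʳ i, [G i, K i]) {i j : ι} (hj : j ≠ i) :
    (γ * (RestrictedProduct.mulSingle K i (γ i))⁻¹) j = γ j := by
  simp [RestrictedProduct.mul_apply, RestrictedProduct.inv_apply, Pi.mulSingle_eq_of_ne hj]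

/-- **Factorisation along a coordinate.** Every `γ ∈ Πʳ i, [G i, K i]` is `γ = c · ι_i(γ i)` with
`c = γ · ι_i(γ i)⁻¹` having trivial `i`-th coordinate. [folklore] -/
theorem eq_mul_mulSingle (γ : Πʳ i, [G i, K i]) (i : ι) :
    γ = γ * (RestrictedProduct.mulSingle K i (γ i))⁻¹ * RestrictedProduct.mulSingle K i (γ i) := by
  rw [inv_mul_cancel_right]

/-- **Factorisation along a coordinate, with commutation** (the hypothesis `hφ` of
`fixedPoints_comp_eq_bot_of_inf_eq_bot` in `FlathLocalLemmas` for `φ = mulSingleHom K i`): every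
`γ` is `c · ι_i(a)` with `c` commuting with `ι_i(G i)`. [folklore] -/
theorem exists_eq_mul_mulSingleHom (i : ι) (γ : Πʳ i, [G i, K i]) :
    ∃ c : Πʳ i, [G i, K i], ∃ a : G i, γ = c * mulSingleHom K i a ∧
      ∀ h : G i, c * mulSingleHom K i h = mulSingleHom K i h * c :=
  ⟨γ * (RestrictedProduct.mulSingle K i (γ i))⁻¹, γ i, eq_mul_mulSingle γ i, fun h =>
    mul_mulSingle_comm_of_apply_eq_one (mul_mulSingle_inv_apply_self γ i) h⟩

/-- Coordinate embeddings at distinct indices commute. [folklore] -/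
theorem mulSingle_commute_of_ne {i j : ι} (hij : i ≠ j) (x : G i) (y : G j) :
    Commute (RestrictedProduct.mulSingle K i x) (RestrictedProduct.mulSingle K j y) :=
  mul_mulSingle_comm_of_apply_eq_one (RestrictedProduct.mulSingle_eq_of_ne' K x hij) y

end Coordinate

/-! ### Box subgroups -/

section Box

/-- The **box subgroup** `∏ L i = {g | ∀ i, g i ∈ L i}` of `Πʳ i, [G i, K i]` attached to a family
of subgroups `L i ≤ G i` (typically `L i = K i` for almost all `i`: the compact open subgroups
`K_S' × K^S` of Flath 1979, §2, Example 2; Bump 1997, §3.3, p. 294). [folklore] -/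
def boxSubgroup (L : ∀ i, Subgroup (G i)) : Subgroup (Πʳ i, [G i, K i]) where
  carrier := {g | ∀ i, g i ∈ L i}
  one_mem' i := by
    rw [RestrictedProduct.one_apply]
    exact (L i).one_mem
  mul_mem' ha hb i := by
    rw [RestrictedProduct.mul_apply]
    exact (L i).mul_mem (ha i) (hb i)
  inv_mem' ha i := by
    rw [RestrictedProduct.inv_apply]
    exact (L i).inv_mem (ha i)

/-- Membership in a box subgroup. [folklore] -/
@[simp] theorem mem_boxSubgroup_iff {L : ∀ i, Subgroup (G i)} {g : Πʳ i, [G i, K i]} :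
    g ∈ boxSubgroup (K := K) L ↔ ∀ i, g i ∈ L i := Iff.rfl

/-- The carrier of a box subgroup. [folklore] -/
theorem coe_boxSubgroup (L : ∀ i, Subgroup (G i)) :
    (boxSubgroup (K := K) L : Set (Πʳ i, [G i, K i])) = {g | ∀ i, g i ∈ L i} := rfl

/-- Box subgroups are monotone in the family. [folklore] -/
theorem boxSubgroup_mono {L L' : ∀ i, Subgroup (G i)} (h : ∀ i, L i ≤ L' i) :
    boxSubgroup (K := K) L ≤ boxSubgroup L' := fun _ hg i => h i (hg i)

variable [DecidableEq ι]

/-- `ι_i(x)` lies in the box `∏ L j` iff `x ∈ L i`. [folklore] -/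
theorem mulSingle_mem_boxSubgroup_iff {L : ∀ i, Subgroup (G i)} {i : ι} {x : G i} :
    RestrictedProduct.mulSingle K i x ∈ boxSubgroup L ↔ x ∈ L i := by
  refine ⟨fun h => by simpa using h i, fun h j => ?_⟩
  by_cases hj : j = i
  · subst hj
    simpa using h
  · simp [Pi.mulSingle_eq_of_ne hj, (L j).one_mem]

/-- If `g` lies in the box with `i`-th side replaced by `L'`, then `g · ι_i(g i)⁻¹` lies in the
original box `∏ L j` (its `i`-th coordinate is `1`). [folklore] -/
theorem mul_mulSingle_inv_mem_boxSubgroup {L : ∀ i, Subgroup (G i)} {i : ι} {L' : Subgroup (G i)}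
    {g : Πʳ i, [G i, K i]} (hg : g ∈ boxSubgroup (K := K) (Function.update L i L')) :
    g * (RestrictedProduct.mulSingle K i (g i))⁻¹ ∈ boxSubgroup (K := K) L := by
  intro j
  by_cases hj : j = i
  · subst hj
    rw [mul_mulSingle_inv_apply_self]
    exact (L j).one_mem
  · rw [mul_mulSingle_inv_apply_of_ne g hj]
    have := hg j
    rwa [Function.update_of_ne hj] at this

/-- The `i`-th coordinate of an element of the box with `i`-th side `L'` lies in `L'`. [folklore] -/
theorem apply_mem_of_mem_boxSubgroup_update {L : ∀ i, Subgroup (G i)} {i : ι} {L' : Subgroup (G i)}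
    {g : Πʳ i, [G i, K i]} (hg : g ∈ boxSubgroup (K := K) (Function.update L i L')) :
    g i ∈ L' := by
  have := hg i
  rwa [Function.update_self] at this

/-- An element of a box is the product of its `i`-th coordinate part and an element of the box
with trivial `i`-th coordinate. [folklore] -/
theorem exists_mem_boxSubgroup_eq_mul_mulSingle {L : ∀ i, Subgroup (G i)} {i : ι}
    {L' : Subgroup (G i)} {g : Πʳ i, [G i, K i]}
    (hg : g ∈ boxSubgroup (K := K) (Function.update L i L')) :
    ∃ c ∈ boxSubgroup (K := K) L, c i = 1 ∧ g i ∈ L' ∧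
      g = c * RestrictedProduct.mulSingle K i (g i) :=
  ⟨_, mul_mulSingle_inv_mem_boxSubgroup hg, mul_mulSingle_inv_apply_self g i,
    apply_mem_of_mem_boxSubgroup_update hg, eq_mul_mulSingle g i⟩

end Box

/-! ### Topology: continuity of the coordinate embeddings, open and compact boxes -/

section Topology

variable [∀ i, TopologicalSpace (G i)]

/-- The coordinate embedding `x ↦ (1, …, x, …, 1)` into the restricted product is continuous
(it factors through the chart `Πʳ i, [G i, K i]_[𝓟 {i}ᶜ]`, which carries the product topology).
[folklore] -/
theorem continuous_mulSingle [DecidableEq ι] (i : ι) :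
    Continuous (RestrictedProduct.mulSingle K i : G i → Πʳ i, [G i, K i]) := by
  have hS : (cofinite : Filter ι) ≤ 𝓟 ({i}ᶜ : Set ι) := by
    rw [Filter.le_principal_iff]
    exact (Set.finite_singleton i).compl_mem_cofinite
  let f₀ : G i → Πʳ i, [G i, (K i : Set (G i))]_[𝓟 ({i}ᶜ : Set ι)] := fun x =>
    ⟨Pi.mulSingle i x, Filter.eventually_principal.2 fun j hj => by
      rw [Pi.mulSingle_eq_of_ne (by simpa using hj)]
      exact (K j).one_mem⟩
  have hf₀ : Continuous f₀ :=
    RestrictedProduct.continuous_rng_of_principal.2 (_root_.continuous_mulSingle i)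
  have heq : (RestrictedProduct.mulSingle K i : G i → Πʳ i, [G i, K i]) =
      RestrictedProduct.inclusion (fun i => G i) (fun i => (K i : Set (G i))) hS ∘ f₀ := by
    funext x
    rfl
  rw [heq]
  exact (RestrictedProduct.continuous_inclusion hS).comp hf₀

/-- `mulSingleHom K i` is continuous. [folklore] -/
theorem continuous_mulSingleHom [DecidableEq ι] (i : ι) :
    Continuous (mulSingleHom K i : G i → Πʳ i, [G i, K i]) :=
  continuous_mulSingle i

/-- A box `∏ L i` with open sides, `K i ≤ L i` for almost all `i`, is open in `Πʳ i, [G i, K i]`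
(`isOpen_setOf_forall_mem_restrictedProduct`). [folklore] -/
theorem isOpen_boxSubgroup {L : ∀ i, Subgroup (G i)} (hL : ∀ i, IsOpen (L i : Set (G i)))
    (hKL : ∀ᶠ i in cofinite, K i ≤ L i) :
    IsOpen (boxSubgroup (K := K) L : Set (Πʳ i, [G i, K i])) :=
  isOpen_setOf_forall_mem_restrictedProduct (A := fun i => (K i : Set (G i)))
    (B := fun i => (L i : Set (G i))) hL hKL

/-- A box `∏ L i` with compact sides `L i ≤ K i` is compact: it is the image of the compact
`∏ L i ⊆ ∏ K i` under the (continuous) structure map. [folklore] -/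
theorem isCompact_boxSubgroup {L : ∀ i, Subgroup (G i)} (hLK : ∀ i, L i ≤ K i)
    (hLc : ∀ i, IsCompact (L i : Set (G i))) :
    IsCompact (boxSubgroup (K := K) L : Set (Πʳ i, [G i, K i])) := by
  let T : ∀ i, Set ↥(K i : Set (G i)) := fun i => Subtype.val ⁻¹' (L i : Set (G i))
  have hT : ∀ i, IsCompact (T i) := fun i => by
    refine Topology.IsInducing.subtypeVal.isCompact_iff.2 ?_
    have : Subtype.val '' T i = (L i : Set (G i)) := by
      rw [Set.image_preimage_eq_inter_range, Subtype.range_coe_subtype]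
      exact Set.inter_eq_left.2 fun x hx => hLK i hx
    rw [this]
    exact hLc i
  have hpi : IsCompact (Set.pi Set.univ T) := isCompact_univ_pi hT
  have himage : (boxSubgroup (K := K) L : Set (Πʳ i, [G i, K i])) =
      RestrictedProduct.structureMap G (fun i => (K i : Set (G i))) cofinite '' Set.pi Set.univ T := by
    ext g
    constructor
    · intro hg
      refine ⟨fun i => ⟨g i, hLK i (hg i)⟩, fun i _ => hg i, DFunLike.ext _ _ fun i => rfl⟩
    · rintro ⟨x, hx, rfl⟩ i
      exact hx i (Set.mem_univ i)
  rw [himage]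
  exact hpi.image RestrictedProduct.isEmbedding_structureMap.continuous

/-- **Small boxes.** Let the `G i` be nonarchimedean topological groups and the `K i` compact
open. Then every neighbourhood `N` of `1` in `Πʳ i, [G i, K i]` contains a box subgroup `∏ L i`
with compact open sides `L i ≤ K i` and `L i = K i` for all but finitely many `i` (so the box is a
compact open subgroup, `isOpen_boxSubgroup`, `isCompact_boxSubgroup`): `𝓝 1` is the image of
`𝓝 1` in `∏ K i` (Mathlib `RestrictedProduct.nhds_eq_map_structureMap`), a basic neighbourhood
there constrains finitely many coordinates, and each constraint contains an open subgroup.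
(Flath 1979, §2, Example 2: the groups `∏_{v ∈ S} K'_v × ∏_{v ∉ S} K_v` form a neighbourhood
basis; Bump 1997, §3.3.) [folklore] -/
theorem exists_boxSubgroup_subset [∀ i, NonarchimedeanGroup (G i)]
    (hK : ∀ i, IsOpen (K i : Set (G i))) (hKc : ∀ i, IsCompact (K i : Set (G i)))
    {N : Set (Πʳ i, [G i, K i])} (hN : N ∈ 𝓝 (1 : Πʳ i, [G i, K i])) :
    ∃ L : ∀ i, Subgroup (G i), (∀ i, IsOpen (L i : Set (G i))) ∧
      (∀ i, IsCompact (L i : Set (G i))) ∧ (∀ i, L i ≤ K i) ∧ (∀ᶠ i in cofinite, L i = K i) ∧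
      (boxSubgroup (K := K) L : Set (Πʳ i, [G i, K i])) ⊆ N := by
  classical
  have h1 : RestrictedProduct.structureMap G (fun i => (K i : Set (G i))) cofinite
      (fun i => ⟨1, (K i).one_mem⟩) = 1 := DFunLike.ext _ _ fun i => rfl
  rw [← h1, RestrictedProduct.nhds_eq_map_structureMap hK, Filter.mem_map, nhds_pi,
    Filter.mem_pi'] at hN
  obtain ⟨I, t, ht, hIt⟩ := hN
  -- in each coordinate, an open subgroup inside the constraint
  have hV : ∀ i, ∃ V : OpenSubgroup (G i), (V : Set (G i)) ⊆ Subtype.val '' t i := fun i => by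
    refine NonarchimedeanGroup.is_nonarchimedean _ ?_
    rw [← (hK i).isOpenEmbedding_subtypeVal.map_nhds_eq ⟨1, (K i).one_mem⟩]
    exact Filter.image_mem_map (ht i)
  choose V hV using hV
  have hVK : ∀ i, (V i : Set (G i)) ⊆ K i := fun i x hx => by
    obtain ⟨y, -, rfl⟩ := hV i hx
    exact y.2
  refine ⟨fun i => if i ∈ I then (V i : Subgroup (G i)) ⊓ K i else K i, fun i => ?_, fun i => ?_,
    fun i => ?_, ?_, ?_⟩
  · by_cases hi : i ∈ I
    · simp only [hi, if_true, Subgroup.coe_inf]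
      exact (V i).isOpen.inter (hK i)
    · simp only [hi, if_false]
      exact hK i
  · by_cases hi : i ∈ I
    · simp only [hi, if_true, Subgroup.coe_inf]
      exact (hKc i).inter_left (V i).isClosed
    · simp only [hi, if_false]
      exact hKc i
  · by_cases hi : i ∈ I
    · simp only [hi, if_true]
      exact inf_le_right
    · simp only [hi, if_false]
      exact le_rfl
  · refine I.eventually_cofinite_notMem.mono fun i hi => ?_
    simp only [hi, if_false]
  · intro g hg
    have hgK : ∀ i, g i ∈ K i := fun i => by
      have := hg i
      by_cases hi : i ∈ I
      · simp only [hi, if_true] at this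
        exact this.2
      · simpa only [hi, if_false] using this
    have hx : (fun i => (⟨g i, hgK i⟩ : ↥(K i : Set (G i)))) ∈ (↑I : Set ι).pi t := by
      intro i hi
      have hgi := hg i
      simp only [Finset.mem_coe.1 hi, if_true] at hgi
      obtain ⟨y, hy, hyg⟩ := hV i hgi.1
      have : y = ⟨g i, hgK i⟩ := Subtype.ext hyg
      show (⟨g i, hgK i⟩ : ↥(K i : Set (G i))) ∈ t i
      rw [← this]
      exact hy
    have := hIt hx
    rw [Set.mem_preimage] at this
    have hg' : RestrictedProduct.structureMap G (fun i => (K i : Set (G i))) cofinite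
        (fun i => ⟨g i, hgK i⟩) = g := DFunLike.ext _ _ fun i => rfl
    rwa [hg'] at this

end Topology

end Literature.NumberTheory.Automorphic
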